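import Summits.BirchSwinnertonDyer.BirchSwinnertonDyer.Theorems.EisensteinPrimesX2AnalyticMuOrbitSum
import HarnessLib

/-!
# Crux `MazurMCOnCellB` (stmt-BirchSwinnertonDyer-19033), line `mudescent` v4, stub 3′ (μ-lineage): the LEVEL-ONE
# Teichmüller-orbit sum at `p ‖ N` — it VANISHES at a split prime (the trivial zero read in symbol currency), so every
# orbit-sum witness of `X2.AnalyticMuLE` at a split pair has level `≥ 2`; at a non-split prime it is `−2·[0]⁺_f`
# (helper; theorems only, no definition, no named fact)

Cell `bsd-eis`, D-0154 width seat `bsd-line-x2-p1-w2` (gen 3); sequel of `…X2AnalyticMuOrbitSum` (p615678: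
`X2.AnalyticMuLE W p m ⟺ ∃ n ≥ 1, ∃ unit u, p^{-(m+1)} < ‖ϖ·T_n(u)‖`, `T_n(u) = ∑_{η^{p−1}=1}[ηu/pⁿ]⁺_f`). At level `n = 1` the
Teichmüller orbit of a unit is ALL of `(ℤ/p)ˣ`, so `T_1(u) = ∑_{a ≢ 0 (p)} [a/p]⁺_f = (a_p − 1)·[0]⁺_f` by the `U_p`-relation at
`p ∣ N` (Mazur–Tate–Teitelbaum §I.10, `ε(p) = 0`; tree: `sum_units_ratPlusSymbol_eq_zero` at `a_p = 1`,
`sum_units_signed_ratPlusSymbol_eq` at `a_p = −1`):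

* `teichOrbitSum_one_eq_zero_of_split` — split multiplicative `p` (odd): `T_1(u) = 0` for every unit `u` (the exceptional
  zero `L_p(E,0) = 0` in orbit currency). Consequently (`analyticMuLE_iff_forall_exists_teichOrbitSum_two_le_of_split`) the
  orbit-sum reading of `X2.AnalyticMuLE W p m` at a SPLIT pair has its witness at a level `n ≥ 2` — the cusps `ηu/pⁿ`,
  `n ≥ 2`, of the seat's memo ORBITSPAN (where `T_n(u) = T_n(u) − T_1(1)` becomes the period of a CLOSED class).
* `teichOrbitSum_one_eq_of_nonsplit` — non-split multiplicative `p` (odd): `T_1(u) = −2·[0]⁺_f` (`= −2·L(f,1)/Ω⁺_f`); with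
  p615678 this recovers -w2 g2's special-value criterion (`…X2AnalyticMuBound.analyticMuLE_of_not_split_of_lvalue_eq`) as
  the level-one case of the orbit reading.

HONEST FRAMING: elementary bookkeeping for the instrument / the memo; nothing about any curve asserted; closes no stub;
beyond-print theorem: no. References: [MazurTateTeitelbaum1986Invent] §I.4 (4.2), §I.10, §I.15; [GreenbergLNM1716] §4 (PDF p. 113).
-/

set_option autoImplicit false
noncomputable section
open Filter Topology
open scoped Classical MatrixGroups ModularForm
open CongruenceSubgroup WeierstrassCurve Literature.NumberTheory.EllipticCurves
  Literature.NumberTheory.EllipticCurves.ModularForms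
  Literature.NumberTheory.EllipticCurves.Rank1Residual
  Summit.BirchSwinnertonDyer.Rank1Residual
  Summit.BirchSwinnertonDyer.BirchSwinnertonDyer.Theorems.EisensteinPrimesX2AnalyticMuOrbitSum

set_option linter.dupNamespace false -- summit and sub-problem share a name (D-0017 layout)
namespace Summit.BirchSwinnertonDyer.BirchSwinnertonDyer.Theorems.EisensteinPrimesX2OrbitSumLevelOne
variable {p : ℕ} [Fact p.Prime]

section LevelOne

variable {W : WeierstrassCurve ℚ} {N : ℕ} {f : CuspForm (Gamma0 N) 2}

/-- **The level-one orbit sum is the sum over ALL units mod `p`** (`p` odd): for a unit `u mod p`,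
`((T_1(u) : ℚ) : ℚ_p) = ∑_{a ∈ (ℤ/p)ˣ} [a/p]⁺_f` — the Teichmüller set modulo `p` is `(ℤ/p)ˣ` itself.
[cite: MazurTateTeitelbaum1986Invent, §I.10 (10.1)] -/
theorem ratCast_teichOrbitSum_one_eq_sum_units (hp2 : p ≠ 2) (u : (ZMod (p ^ 1))ˣ) :
    ((teichOrbitSum f p 1 (u : ZMod (p ^ 1)) : ℚ) : ℚ_[p]) =
      ∑ a : (ZMod (p ^ 1))ˣ, (ratPlusSymbol f (((a : ZMod (p ^ 1)).val : ℚ) / (p : ℚ) ^ 1) : ℚ_[p]) := by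
  classical
  haveI := neZero_torsionOrder p
  haveI := Fintype.ofFinite (rootsOfUnity (torsionOrder p) ℤ_[p])
  haveI : NeZero (p ^ 0) := ⟨pow_ne_zero _ (Fact.out : p.Prime).ne_zero⟩
  have he : cyclotomicExponent p = 1 := if_neg hp2
  -- `u` is a Teichmüller representative modulo `p`, so `T_1(u) = T_1(1)`
  obtain ⟨ξ₀, s₀, hu⟩ := exists_coe_eq_toZModPow_mul_pow hp2 0 u
  have hp0 : p ^ 0 = 1 := pow_zero p
  have hs₀ : s₀.val = 0 := by
    have h := ZMod.val_lt s₀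
    omega
  rw [hs₀, pow_zero] at hu
  rw [hu, teichOrbitSum_toZModPow_mul f hp2 le_rfl ξ₀ 1, teichOrbitSum_eq_finsum f hp2 le_rfl,
    finsum_eq_sum_of_fintype, Rat.cast_sum]
  -- the classes `η̄ γˢ`, `s mod p⁰`, are the units modulo `p^{e₀}`
  have hcl := finsum_sum_classes_eq_sum_units (p := p) 0
    (fun b : ZMod (p ^ (0 + cyclotomicExponent p)) ↦ (ratPlusSymbol f ((b.val : ℚ) /
      (p : ℚ) ^ (0 + cyclotomicExponent p)) : ℚ_[p]))
  rw [Nat.zero_add, he] at hcl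
  rw [← hcl, finsum_eq_sum_of_fintype]
  refine Finset.sum_congr rfl fun ξ _ ↦ ?_
  have hconst : ∀ s : ZMod (p ^ 0), (cyclotomicGenerator p : ZMod (p ^ 1)) ^ s.val = 1 := fun s ↦ by
    have h := ZMod.val_lt s
    have hs : s.val = 0 := by omega
    rw [hs, pow_zero]
  simp only [hconst, mul_one, Finset.sum_const, Finset.card_univ, ZMod.card, pow_zero, one_smul]

/-- **SPLIT multiplicative `p` (odd): the level-one orbit sum VANISHES**, `T_1(u) = ∑_{a ≢ 0}[a/p]⁺_f = (a_p − 1)[0]⁺_f = 0`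
— the exceptional zero of the Mazur–Tate–Teitelbaum function in orbit-sum currency (tree: `sum_units_ratPlusSymbol_eq_zero`).
[cite: MazurTateTeitelbaum1986Invent, §I.10 (ε(p) = 0, α = a_p = 1) and §I.15] -/
theorem teichOrbitSum_one_eq_zero_of_split [NeZero N] (hp2 : p ≠ 2) (hsplit : W.HasSplitMultiplicativeReductionAtPrime p)
    (hf : IsNewformOf W f) (u : (ZMod (p ^ 1))ˣ) : teichOrbitSum f p 1 (u : ZMod (p ^ 1)) = 0 := by
  have he : cyclotomicExponent p = 1 := if_neg hp2
  have hrat : ∀ r : ℚ, (ratPlusSymbol f r : ℝ) = normalizedPlusSymbol f r :=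
    ratCast_ratPlusSymbol_holds hf.1 hf.coeffField_eq_bot
  have h0 := sum_units_ratPlusSymbol_eq_zero (p := p) hrat hf.1 (hf.dvd_level_of_split hsplit)
    (hf.cuspCoeff_eq_one_and_sq_of_split hsplit).1
  rw [he] at h0
  have h : ((teichOrbitSum f p 1 (u : ZMod (p ^ 1)) : ℚ) : ℚ_[p]) = 0 := by
    rw [ratCast_teichOrbitSum_one_eq_sum_units hp2 u, h0]
  exact_mod_cast h

/-- **NON-SPLIT multiplicative `p` (odd): the level-one orbit sum is `−2·[0]⁺_f`** (`a_p = −1`: `(a_p − 1)[0]⁺ = −2 L(f,1)/Ω⁺_f`,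
no exceptional zero; tree: `sum_units_signed_ratPlusSymbol_eq`). [cite: MazurTateTeitelbaum1986Invent, §I.10 (ε(p) = 0, α = a_p = −1)]
[cite: GreenbergLNM1716, §4 (PDF p. 113)] -/
theorem teichOrbitSum_one_eq_of_nonsplit [NeZero N] (hp2 : p ≠ 2) (hmult : W.HasMultiplicativeReductionAtPrime p)
    (hns : ¬ W.HasSplitMultiplicativeReductionAtPrime p) (hf : IsNewformOf W f) (u : (ZMod (p ^ 1))ˣ) :
    teichOrbitSum f p 1 (u : ZMod (p ^ 1)) = -2 * ratPlusSymbol f 0 := by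
  have he : cyclotomicExponent p = 1 := if_neg hp2
  have hrat : ∀ r : ℚ, (ratPlusSymbol f r : ℝ) = normalizedPlusSymbol f r :=
    ratCast_ratPlusSymbol_holds hf.1 hf.coeffField_eq_bot
  obtain ⟨hap, hpN⟩ := hf.cuspCoeff_eq_neg_one_and_dvd_of_nonsplit hmult hns
  have h0 := sum_units_signed_ratPlusSymbol_eq (p := p) hrat hf.1 hpN hap
  rw [he, pow_one (-1 : ℚ_[p])] at h0
  simp only [neg_one_mul, Finset.sum_neg_distrib, neg_eq_iff_eq_neg] at h0
  have h : ((teichOrbitSum f p 1 (u : ZMod (p ^ 1)) : ℚ) : ℚ_[p]) = ((-2 * ratPlusSymbol f 0 : ℚ) : ℚ_[p]) := by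
    rw [ratCast_teichOrbitSum_one_eq_sum_units hp2 u, h0]
    push_cast
    ring
  exact_mod_cast h

end LevelOne

section Split

variable {W : WeierstrassCurve ℚ} [W.IsElliptic] [W.IsGloballyMinimal]

/-- **At a SPLIT pair every orbit-sum witness has level `≥ 2`.** For `W/ℚ` split multiplicative at an odd `p` and every `m`:
`X2.AnalyticMuLE W p m ⟺ ∀ newform f, ∀ ϖ, ∃ n ≥ 2, ∃ unit u mod pⁿ, p^{-(m+1)} < ‖ϖ·T_n(u)‖_p` — the reading of p615678 with
the level-one sums removed (they vanish, `teichOrbitSum_one_eq_zero_of_split`). These are the cusps `ηu/pⁿ`, `n ≥ 2`, all in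
the class of `1/p`, so each witnessing `T_n(u)` is the plus period of a CLOSED class on `X₀(N)` (memo ORBITSPAN §1).
[cite: MazurTateTeitelbaum1986Invent, §I.10 and §I.12–I.13] -/
theorem analyticMuLE_iff_forall_exists_teichOrbitSum_two_le_of_split (hp2 : p ≠ 2)
    (hsplit : W.HasSplitMultiplicativeReductionAtPrime p) (m : ℕ) :
    X2.AnalyticMuLE W p m ↔
      ∀ {N : ℕ} [NeZero N] (f : CuspForm (Gamma0 N) 2), IsNewformOf W f →
        ∀ (ϖ : ℚ), (ϖ : ℝ) * W.realPeriodRat = plusPeriod f →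
          ∃ n : ℕ, 2 ≤ n ∧ ∃ u : (ZMod (p ^ n))ˣ,
            (p : ℝ) ^ (-((m : ℤ) + 1)) < ‖((ϖ * teichOrbitSum f p n (u : ZMod (p ^ n)) : ℚ) : ℚ_[p])‖ := by
  rw [analyticMuLE_iff_forall_exists_teichOrbitSum hp2 hsplit.hasMultiplicativeReductionAtPrime m]
  constructor
  · intro h N _ f hf ϖ hϖ
    obtain ⟨n, hn, u, hu⟩ := h f hf ϖ hϖ
    rcases Nat.lt_or_ge n 2 with hlt | hge
    · obtain rfl : n = 1 := by omega
      rw [teichOrbitSum_one_eq_zero_of_split hp2 hsplit hf u, mul_zero, Rat.cast_zero, norm_zero] at hu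
      exact absurd hu (not_lt.mpr (by positivity))
    · exact ⟨n, hge, u, hu⟩
  · intro h N _ f hf ϖ hϖ
    obtain ⟨n, hn, u, hu⟩ := h f hf ϖ hϖ
    exact ⟨n, by omega, u, hu⟩

end Split

end Summit.BirchSwinnertonDyer.BirchSwinnertonDyer.Theorems.EisensteinPrimesX2OrbitSumLevelOne

end
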